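import Summits.BirchSwinnertonDyer.BirchSwinnertonDyer.Theorems.Rank2ObservatoryRank3MinimalCensus
import HarnessLib

/-!
# BSD rank ≥ 2 observatory (`b2b-bsdr2`): the rank-3 census over the Heegner field, indexed form
# for the 5 347 TAME rows — root number, conductor and minimality all read off the kernel certificates

HONEST FRAMING: per-curve certified theorems and census instruments; no claim on BSD in rank ≥ 2.

User-facing packaging of the three certificate censuses (`Rank2ObservatoryRank3RootNumberCensus`,
`…Rank3ConductorCensus`, `…Rank3MinimalCensus`): for a row INDEX `i` whose listed certificate
`rank3RNCerts[i] = some c` is tame (`c.tame`, a kernel `decide` per row; `5347` rows by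
`rank3Table_condCount`), `L′(E,1) = 0` follows from modularity (`hE`), Gross–Zagier–Kolyvagin over `K`
(`hGZKK`), the named facts on the root number (`hKD`) and on conductor exponents (`h0 h1 h2 h5 hf`), the
Heegner field data (`hK`, `hdK`) and the twist value `hLD : L(E^D,1) ≠ 0` — with `w(E) = −1`,
`N(E) = N` and global minimality of Cremona's equation no longer assumed but CERTIFIED.

* `min2_of_tame_of_idx` (from the kernel fact `rank3Table_tame_imp_min2`);
* `Rank3Row.rank3_lderiv_eq_zero_kernel_tame` (indexed headline); `rank3RNCerts_zero`, `rank3Table_zero_tame`.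

References: Gross 1991 [GrossLMS1991]; Kellock–Dokchitser 2023 [KellockDokchitser2023]; Silverman ATAEC
[Silverman1994]; Cremona 1997 [CremonaAlgorithms1997].
-/

set_option linter.dupNamespace false
set_option autoImplicit false

open WeierstrassCurve IsDedekindDomain Literature Literature.NumberTheory.EllipticCurves

namespace Summit.BirchSwinnertonDyer.BirchSwinnertonDyer.Rank2Observatory

open RootNumber

/-- A TAME listed certificate passes the minimality criterion `min2` (read off the kernel fact
`rank3Table_tame_imp_min2`). [folklore] -/
theorem min2_of_tame_of_idx {i : ℕ} (hi : i < rank3Table.length) {c : RNCert}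
    (hc : rank3RNCerts[i]? = some (some c)) (ht : c.tame (rank3Table[i]'hi).intModel = true) :
    c.min2 (rank3Table[i]'hi).intModel = true := by
  obtain ⟨hi2, hc2⟩ := List.getElem?_eq_some_iff.mp hc
  have hmem : ((rank3Table[i]'hi), some c) ∈ rank3Table.zip rank3RNCerts := by
    rw [← hc2]
    have hiz : i < (rank3Table.zip rank3RNCerts).length := by
      rw [List.length_zip]; exact lt_min hi hi2
    have := List.getElem_mem hiz
    rwa [List.getElem_zip] at this
  have h := List.all_eq_true.mp rank3Table_tame_imp_min2 _ hmem
  simp only [ht, Bool.not_true, Bool.false_or] at h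
  exact h

/-- **`L′(E,1) = 0` over the Heegner field for tame row `i` of the rank-3 census** — `w(E) = −1`,
`N(E) = N` and global minimality CERTIFIED in the kernel from the listed certificate; remaining
hypotheses: modularity `hE`, Gross–Zagier–Kolyvagin over `K` (`hGZKK`), the named facts `hKD`,
`h0 h1 h2 h5 hf`, the field `K` (`hK`, `hdK`) and `hLD : L(E^D,1) ≠ 0`.
[cite: GrossLMS1991, (1.1) and Thm. 1.3] [cite: KellockDokchitser2023, Thm. 2.3 and §5]
[cite: Silverman1994, IV.10.2 and IV.10.4] -/
theorem Rank3Row.rank3_lderiv_eq_zero_kernel_tame {i : ℕ} (hi : i < rank3Table.length) {c : RNCert}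
    (hc : rank3RNCerts[i]? = some (some c)) (ht : c.tame (rank3Table[i]'hi).intModel = true)
    (K : Type) [Field K] [NumberField K] (hE : WeierstrassCurve.hasEntireLFunction_rat)
    (hGZKK : mordellWeilRank_eq_one_of_LDerivEK_ne_zero (rank3Table[i]'hi).curve K)
    (h0 : ∀ v : HeightOneSpectrum ℤ, conductorExponent_eq_zero_iff v (rank3Table[i]'hi).curve)
    (h1 : ∀ v : HeightOneSpectrum ℤ, conductorExponent_eq_one_iff v (rank3Table[i]'hi).curve)
    (h2 : ∀ v : HeightOneSpectrum ℤ, two_le_conductorExponent_iff v (rank3Table[i]'hi).curve)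
    (h5 : ∀ v : HeightOneSpectrum ℤ,
      conductorExponent_le_two_of_five_le_natGenerator (rank3Table[i]'hi).curve v)
    (hf : ∀ v : HeightOneSpectrum ℤ, factorization_conductorNorm (rank3Table[i]'hi).curve v)
    (hK : IsImaginaryQuadratic K) (hdK : NumberField.discr K = (rank3Table[i]'hi).D)
    (hKD : (rank3Table[i]'hi).curve.rootNumber_eq_neg_finprod_tableLocalRootNumberAt')
    (hLD : ((rank3Table[i]'hi).curve.quadraticTwist ((rank3Table[i]'hi).D : ℚ)).entireLFunction 1 ≠ 0) :
    deriv (rank3Table[i]'hi).curve.entireLFunction 1 = 0 :=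
  Rank3Row.rank3_lderiv_eq_zero_kernel_rnNm (List.getElem_mem hi)
    (Rank3Row.rootNumberCertified_of_idx hi hc) (Rank3Row.conductorCertified_of_idx hi hc ht)
    (Rank3Row.minimalCertified_of_idx hi hc (min2_of_tame_of_idx hi hc ht)) K hE hGZKK h0 h1 h2 h5 hf
    hK hdK hKD hLD

/-- Row `0` is `5077a1`; its listed certificate is `⟨0, 4, 3, [(5077: non-split)]⟩` (kernel).
[cite: CremonaAlgorithms1997, Tables] -/
theorem rank3RNCerts_zero : rank3RNCerts[0]? = some (some ⟨0, 4, 3, [⟨5077, 71, 1, 0, 0⟩]⟩) := by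
  decide +kernel

/-- Row `0` (`5077a1`) carries a TAME certificate (kernel), so `Rank3Row.rank3_lderiv_eq_zero_kernel_tame`
applies to it with `i = 0`. [cite: CremonaAlgorithms1997, Tables] -/
theorem rank3Table_zero_tame :
    ∃ c : RNCert, rank3RNCerts[0]? = some (some c) ∧
      c.tame (rank3Table[0]'(by rw [rank3Table_length]; norm_num)).intModel = true :=
  ⟨_, rank3RNCerts_zero, by decide +kernel⟩

end Summit.BirchSwinnertonDyer.BirchSwinnertonDyer.Rank2Observatory
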